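import Literature.Analysis.FluidPDE.PineauVicolCylinderRegularity
import Literature.Analysis.FluidPDE.SelfSimilar
import HarnessLib

/-!
# Crux `HubbleDynamo.NoSelfExcitedDynamo` (stmt-NavierStokesRegularity-1934), line `registered`:
# stub `stub_derivativeDecay` — scale-invariant derivative bounds of Type I classical solutions

Helper file (`--supports stmt-NavierStokesRegularity-1934`; theorems only, sorry-free). A classical
solution `(v, p)` of the unforced Navier–Stokes system with unit viscosity on the whole past
`(−∞, 0) × ℝ³` with the pointwise Type I bound `‖v(t, x)‖ ≤ C / (‖x‖ + √(−t))`
(`HasTypeIDecay C v`) has all space derivatives Type I in space–time: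
`‖Dᵏₓ v(t, ·)(x)‖ ≤ C_k / (‖x‖ + √(−t))^{k+1}` for every `k`, `t < 0`, `x`.

Proof. Pineau–Vicol 2026, Lemma 7.1 in physical variables, in the tree as
`Literature.Analysis.FluidPDE.PineauVicol2026.exists_forall_iteratedFDeriv_le_of_typeI`, gives
`‖Dᵏₓ v(t, ·)(x)‖ ≤ K · (max{‖x‖, √(−t)})^{−(k+1)}` with `K = K(k, C)`; since
`max{a, b} ≥ (a + b)/2` for `a = ‖x‖ ≥ 0`, `b = √(−t) > 0`, one has
`(max{a, b})⁻¹ ≤ 2/(a + b)` and the claim follows with `C_k = K · 2^{k+1}`.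

## References

* B. Pineau, V. Vicol, arXiv:2607.09619 (2026), Lemma 7.1. [PineauVicol2026]
* G. Koch, N. Nadirashvili, G. Seregin, V. Šverák, Acta Math. 203 (2009), (1.6) (the Type I
  class). [KNSS2009]
-/

noncomputable section

-- the registered stub namespace repeats the summit name `NavierStokesRegularity` (summit = problem)
set_option linter.dupNamespace false

namespace Summit.NavierStokesRegularity.NavierStokesRegularity.Theorems.NoSelfExcitedDynamo.Registered

open Set MeasureTheory Filter Topology
open Literature.Analysis.FluidPDE

/-- The elementary comparison behind the change of gauge `max{a, b} ↝ a + b`: for `0 ≤ a` and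
`0 < b`, `(max{a, b})⁻¹ ≤ 2 / (a + b)`. -/
private theorem derivDecay_inv_max_le {a b : ℝ} (ha : 0 ≤ a) (hb : 0 < b) :
    (max a b)⁻¹ ≤ 2 / (a + b) := by
  have hm : 0 < max a b := lt_max_of_lt_right hb
  have hs : 0 < a + b := by positivity
  rw [inv_eq_one_div, div_le_div_iff₀ hm hs]
  have h1 := le_max_left a b
  have h2 := le_max_right a b
  linarith

/-- **Stub `stub_derivativeDecay`** (Pineau–Vicol 2026, Lemma 7.1 in physical variables). A
classical solution `(v, p)` of Navier–Stokes (`ν = 1`, `f = 0`) on the whole past `Iio 0` with the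
pointwise Type I bound `‖v(t, x)‖ ≤ C / (‖x‖ + √(−t))` has ALL space derivatives Type I in
space–time: for every `k` there is `C'` with `‖Dᵏ v(t, ·)(x)‖ ≤ C' / (‖x‖ + √(−t))^{k+1}` for all
`t < 0` and `x`. From `PineauVicol2026.exists_forall_iteratedFDeriv_le_of_typeI` and
`max{‖x‖, √(−t)} ≥ ½ (‖x‖ + √(−t))`, with `C' = K · 2^{k+1}`. -/
theorem stub_derivativeDecay :
    ∀ (v : ℝ → EuclideanSpace ℝ (Fin 3) → EuclideanSpace ℝ (Fin 3)) (p : ℝ → EuclideanSpace ℝ (Fin 3) → ℝ) (C : ℝ),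
      IsClassicalNSSolutionOn (Iio 0) 1 0 v p → HasTypeIDecay C v →
      ∀ k : ℕ, ∃ C' : ℝ, ∀ t < 0, ∀ x,
        ‖iteratedFDeriv ℝ k (v t) x‖ ≤ C' / (‖x‖ + Real.sqrt (-t)) ^ (k + 1) := by
  intro v p C hsol hdec k
  obtain ⟨K, hK0, hK⟩ := PineauVicol2026.exists_forall_iteratedFDeriv_le_of_typeI k C
  refine ⟨K * 2 ^ (k + 1), fun t ht x => ?_⟩
  have hb : 0 < Real.sqrt (-t) := Real.sqrt_pos.2 (neg_pos.2 ht)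
  have ha : 0 ≤ ‖x‖ := norm_nonneg _
  have hkey : (max ‖x‖ (Real.sqrt (-t)))⁻¹ ≤ 2 / (‖x‖ + Real.sqrt (-t)) :=
    derivDecay_inv_max_le ha hb
  have hI : ∀ s ∈ Iio (0 : ℝ), ∀ y, ‖v s y‖ ≤ C / (‖y‖ + Real.sqrt (-s)) :=
    fun s hs y => hdec s (Set.mem_Iio.1 hs) y
  calc ‖iteratedFDeriv ℝ k (v t) x‖
      ≤ K * ((max ‖x‖ (Real.sqrt (-t)))⁻¹) ^ (k + 1) := hK v p hsol hI t (Set.mem_Iio.2 ht) x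
    _ ≤ K * (2 / (‖x‖ + Real.sqrt (-t))) ^ (k + 1) := by
        gcongr
    _ = K * 2 ^ (k + 1) / (‖x‖ + Real.sqrt (-t)) ^ (k + 1) := by
        rw [div_pow, mul_div_assoc]

end Summit.NavierStokesRegularity.NavierStokesRegularity.Theorems.NoSelfExcitedDynamo.Registered
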